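import Summits.CriticalPhenomena.Ising3DConformalLimit.Theorems.BoundedBoundarySignal.Negative.Dictionary
import Summits.CriticalPhenomena.Ising3DConformalLimit.Theses.ArmHyperscaling
import HarnessLib

/-!
# `OneArmHyperscaling` (stmt-CriticalPhenomena-15591, route ArmHyperscaling) implies
# `BoundedBoundarySignal` (stmt-CriticalPhenomena-18094, route PersistenceSpeed)

Support file for crux stmt-CriticalPhenomena-18094 (redirect strategist r1,
planner-cstrat-stmt-CriticalPhenomena-18094-r1-0, 2026-08-17): the DOMINATION EDGE recorded in
`Cruxes/BoundedBoundarySignal/STRATEGY-CENSUS.md` — the pointwise one-arm hyperscaling crux of route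
ArmHyperscaling implies the box-averaged one `BoundedBoundarySignal`, sorry-free, over the landed dictionary
`Theorems/BoundedBoundarySignal/Negative/Dictionary.lean` (p166987: `bbs_iff_avgOneArm`, `card_sq_mul_axis_le_bulk`).
It is the sorry-free composition of the birth line of BBS (`stub_plusSumLe`, `stub_boxSumGe` are the dictionary
lemmas; the open core is `OneArmHyperscaling` itself), previously available only in the crux workfile
`Cruxes/BoundedBoundarySignal/Disproof.lean` (`bbs_of_oneArmHyperscaling`).

Consequence for staffing: a proof of `FaceSaturation` (the one open stub of OA's registered line
`mirror-face-saturation`, see `Theorems/ArmHyperscalingOneArmHyperscalingReduction.lean`,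
`OneArmHyperscaling_of_faceSaturation`) closes stmt-15591 AND, through this file, stmt-18094.

Proof: OA at ratio `K` with constant `C`, applied at `n = 3L`: `m⁺_{3KL}² ≤ C·G_c(6L e₀)`; MMS box comparison
`|Λ_L|²·G_c(6L e₀) ≤ bulk L` (`card_sq_mul_axis_le_bulk`); hence `|Λ_L|·m⁺_{3KL} ≤ √(max C 0)·√bulk L`, which is
the right-hand side of `bbs_iff_avgOneArm` at ratio `3K`. No unproved fact is used.
-/

noncomputable section

namespace Summit.CriticalPhenomena.Ising3DConformalLimit.PersistenceSpeedBoundedBoundarySignalOfOneArm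

open Literature.Probability.LatticeModels Finset
open Summit.CriticalPhenomena.Ising3DConformalLimit.Theses.PersistenceSpeed (BoundedBoundarySignal)
open Summit.CriticalPhenomena.Ising3DConformalLimit.Theses.ArmHyperscaling (OneArmHyperscaling)
open Summit.CriticalPhenomena.Ising3DConformalLimit.BoundedBoundarySignalNegative

/-- `OneArmHyperscaling` unfolded in the dictionary vocabulary (`boxMag n = ⟨σ₀⟩⁺_{Λ_n,β_c}`); definitional.
[folklore] -/
theorem oneArmHyperscaling_iff :
    OneArmHyperscaling ↔ ∃ K : ℕ, 1 ≤ K ∧ ∃ C : ℝ, ∀ n : ℕ, 1 ≤ n →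
      boxMag (K * n) ^ 2 ≤ C * criticalTwoPoint 3 (Pi.single 0 (2 * (n : ℤ))) :=
  Iff.rfl

/-- One-arm hyperscaling at aspect ratio `K` gives the box-averaged one-arm bound at aspect ratio `3K`:
`|Λ_L| · m⁺_{3KL} ≤ √(max C 0) · √bulk L`. [folklore] -/
theorem avgOneArm_of_oneArmHyperscalingAt {K : ℕ} {C : ℝ}
    (hC : ∀ n : ℕ, 1 ≤ n → boxMag (K * n) ^ 2 ≤ C * criticalTwoPoint 3 (Pi.single 0 (2 * (n : ℤ)))) :
    ∃ A : ℝ, ∀ L : ℕ, 1 ≤ L → (#(box 3 L) : ℝ) * boxMag (3 * K * L) ≤ A * Real.sqrt (bulk L) := by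
  refine ⟨Real.sqrt (max C 0), fun L hL => ?_⟩
  have h1 := hC (3 * L) (by omega)
  have hmul : K * (3 * L) = 3 * K * L := by ring
  rw [hmul] at h1
  have h2 := card_sq_mul_axis_le_bulk L
  have hGnn : 0 ≤ criticalTwoPoint 3 (Pi.single 0 (2 * ((3 * L : ℕ) : ℤ))) :=
    criticalTwoPoint_three_nonneg _
  have hcard : (0 : ℝ) ≤ #(box 3 L) := Nat.cast_nonneg _
  have hm : 0 ≤ boxMag (3 * K * L) := boxMag_nonneg _
  rw [← Real.sqrt_mul (le_max_right _ _),
    Real.le_sqrt (mul_nonneg hcard hm) (mul_nonneg (le_max_right _ _) (bulk_pos L).le)]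
  calc ((#(box 3 L) : ℝ) * boxMag (3 * K * L)) ^ 2
        = (#(box 3 L) : ℝ) ^ 2 * boxMag (3 * K * L) ^ 2 := by ring
    _ ≤ (#(box 3 L) : ℝ) ^ 2 * (max C 0 * criticalTwoPoint 3 (Pi.single 0 (2 * ((3 * L : ℕ) : ℤ)))) := by
        gcongr
        exact h1.trans (mul_le_mul_of_nonneg_right (le_max_left _ _) hGnn)
    _ = max C 0 * ((#(box 3 L) : ℝ) ^ 2 * criticalTwoPoint 3 (Pi.single 0 (2 * ((3 * L : ℕ) : ℤ)))) := by
        ring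
    _ ≤ max C 0 * bulk L := mul_le_mul_of_nonneg_left h2 (le_max_right _ _)

/-- **Domination edge: `OneArmHyperscaling` (stmt-CriticalPhenomena-15591) ⇒ `BoundedBoundarySignal`
(stmt-CriticalPhenomena-18094).** [folklore] -/
theorem boundedBoundarySignal_of_oneArmHyperscaling (h : OneArmHyperscaling) : BoundedBoundarySignal := by
  obtain ⟨K, hK, C, hC⟩ := oneArmHyperscaling_iff.1 h
  obtain ⟨A, hA⟩ := avgOneArm_of_oneArmHyperscalingAt hC
  exact bbs_iff_avgOneArm.2 ⟨3 * K, by omega, A, hA⟩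

end Summit.CriticalPhenomena.Ising3DConformalLimit.PersistenceSpeedBoundedBoundarySignalOfOneArm

end
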